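import Summits.ValiantsHypothesis.ValiantsHypothesis.Theorems.ImmanantSliceClassSumParity
import Literature.Computability.AlgebraicComplexity.PermanentMonotone
import Literature.Computability.AlgebraicComplexity.DefinableVNP
import Literature.Computability.AlgebraicComplexity.ValiantClassesProofs
import Literature.Computability.AlgebraicComplexity.ArithCircuitProofs

/-!
# Route ImmanantSlice — crux `EvenCycleDominance` (stmt-ValiantsHypothesis-4211), closed

`EvenCycleDominance`: if the signed even-cycle-cover family `D^even` is in VP then the permanent is
p-computable. PROVED: the all-ones-return gadget with 3-cycle blocks
(`ImmanantSliceEvenCycleDominanceBlocks.lean`) gives `aeval s (D^even_{3r}) = C(classSumA r) · per_r`,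
and `classSumA (2j) ≠ 0` (`ImmanantSliceClassSumParity.lean`: the number of colourable permutations of
`Fin (2j)` is odd), so `per_{2j} = (classSumA (2j))⁻¹ • (a 0/1-projection of D^even_{6j})` —
`D^even` is permanent-hard under p-projections up to one scalar:

* `complexity_perPoly_le_of_classSumA` — `L(per_r) ≤ L(D^even_{3r}) + 1` whenever `classSumA r ≠ 0`
  (the gadget identity `aeval_evenCycleCover`, one scalar gate, and projections are free);
* `evenCycleDominance_of_classSumA` — `(∀ j, classSumA (2(j+1)) ≠ 0) → EvenCycleDominance`
  (pad `m ≤ 2(⌊m/2⌋+1) ≤ m + 2` with `isProjection_perPoly_of_le`, polynomial bookkeeping with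
  `DefVNP.isPBounded_of_le_poly`);
* `evenCycleDominance_proof : EvenCycleDominance` — the item, verbatim.

Honest framing: a VNP-hardness reduction for one specific slice family (the route's «prime suspect»
D^even is permanent-hard); it confirms a necessary condition of CR and nothing here is progress on
VP ≠ VNP.
-/

set_option linter.dupNamespace false

noncomputable section

namespace Summit.ValiantsHypothesis.ValiantsHypothesis.Theorems.ImmanantSlice

open MvPolynomial Finset Equiv
open Literature.Computability.AlgebraicComplexity

/-- A substitution of variables by variables and constants is a projection. [folklore] -/
theorem isProjection_aeval_substVCFun {σ τ : Type*} (s : σ → τ ⊕ ℂ) (f : MvPolynomial σ ℂ) :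
    IsProjection (aeval (ArithCircuit.substVCFun s) f) f := by
  refine ⟨ArithCircuit.substVCFun s, fun i => ?_, rfl⟩
  unfold ArithCircuit.substVCFun
  cases s i with
  | inl j => exact Or.inl ⟨j, rfl⟩
  | inr c => exact Or.inr ⟨c, rfl⟩

/-- **`L(per_r) ≤ L(D^even_{3r}) + 1`** whenever the class sum `classSumA r` is non-zero:
`per_r = (classSumA r)⁻¹ • aeval s (D^even_{3r})`, the substitution is a projection (free) and the
scalar costs one gate. [folklore] -/
theorem complexity_perPoly_le_of_classSumA (r : ℕ) (hA : classSumA r ≠ 0) :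
    complexity (perPoly (Fin r) ℂ) ≤
      complexity (∑ σ : Perm (Fin (r * 3)), C (if (∀ i, σ i ≠ i) ∧ (∀ m ∈ σ.cycleType, Even m) then
        (((Perm.sign σ : ℤ) : ℂ)) else 0) * ∏ i : Fin (r * 3), X (σ i, i)) + 1 := by
  have hper : perPoly (Fin r) ℂ = (classSumA r)⁻¹ •
      aeval (ArithCircuit.substVCFun (gadgetSubstK ℂ (betaThree r) (blockE r) (blockEquiv r)))
        (∑ σ : Perm (Fin (r * 3)), C (if (∀ i, σ i ≠ i) ∧ (∀ m ∈ σ.cycleType, Even m) then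
          (((Perm.sign σ : ℤ) : ℂ)) else 0) * ∏ i : Fin (r * 3), X (σ i, i)) := by
    rw [aeval_evenCycleCover, smul_eq_C_mul, ← mul_assoc, ← C_mul, inv_mul_cancel₀ hA, C_1, one_mul]
  calc complexity (perPoly (Fin r) ℂ)
      = complexity ((classSumA r)⁻¹ •
          aeval (ArithCircuit.substVCFun (gadgetSubstK ℂ (betaThree r) (blockE r) (blockEquiv r)))
            (∑ σ : Perm (Fin (r * 3)), C (if (∀ i, σ i ≠ i) ∧ (∀ m ∈ σ.cycleType, Even m) then
              (((Perm.sign σ : ℤ) : ℂ)) else 0) * ∏ i : Fin (r * 3), X (σ i, i))) := by rw [← hper]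
    _ ≤ complexity (aeval (ArithCircuit.substVCFun
          (gadgetSubstK ℂ (betaThree r) (blockE r) (blockEquiv r)))
            (∑ σ : Perm (Fin (r * 3)), C (if (∀ i, σ i ≠ i) ∧ (∀ m ∈ σ.cycleType, Even m) then
              (((Perm.sign σ : ℤ) : ℂ)) else 0) * ∏ i : Fin (r * 3), X (σ i, i))) + 1 :=
        complexity_smul_le_holds _ _
    _ ≤ _ := Nat.add_le_add_right (complexity_le_of_isProjection
        (isProjection_aeval_substVCFun _ _)) 1

/-- **Crux `EvenCycleDominance` modulo the class sums.** If `classSumA (2j+2) ≠ 0` for all `j`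
(on paper: `= −(2j+1)!!(2j−1)!!`), then `D^even ∈ VP` implies that the permanent is p-computable:
`per_m` is a projection of `per_{r'}`, `r' = 2(⌊m/2⌋+1) ≤ m + 2`, which costs at most
`L(D^even_{3r'}) + 1`. [folklore] -/
theorem evenCycleDominance_of_classSumA (hA : ∀ j : ℕ, classSumA (2 * (j + 1)) ≠ 0) :
    Theses.ImmanantSlice.EvenCycleDominance := by
  intro hVP
  obtain ⟨c, hc⟩ := hVP.2
  refine DefVNP.isPBounded_of_le_poly
    ((Polynomial.C 3 * Polynomial.X + Polynomial.C 6) ^ c + Polynomial.C (c + 1)) fun m => ?_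
  show complexity (perPoly (Fin m) ℂ) ≤ _
  have hm : m ≤ 2 * (m / 2 + 1) := by omega
  have hr' : 2 * (m / 2 + 1) ≤ m + 2 := by omega
  have h1 : complexity (perPoly (Fin m) ℂ) ≤ complexity (perPoly (Fin (2 * (m / 2 + 1))) ℂ) :=
    complexity_le_of_isProjection (isProjection_perPoly_of_le (k := ℂ) hm)
  have h2 := complexity_perPoly_le_of_classSumA (2 * (m / 2 + 1)) (hA (m / 2))
  have h3 := hc (2 * (m / 2 + 1) * 3)
  have h4 : (2 * (m / 2 + 1) * 3) ^ c ≤ (3 * m + 6) ^ c := Nat.pow_le_pow_left (by omega) c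
  have heval : Polynomial.eval m ((Polynomial.C 3 * Polynomial.X + Polynomial.C 6) ^ c +
      Polynomial.C (c + 1)) = (3 * m + 6) ^ c + (c + 1) := by
    simp [Polynomial.eval_add, Polynomial.eval_pow, Polynomial.eval_mul]
  rw [heval]
  simp only at h3
  omega

/-- **Crux `EvenCycleDominance` (stmt-ValiantsHypothesis-4211).** If the signed even-cycle-cover
family `D^even` is in VP then the permanent is p-computable: the all-ones-return gadget with 3-cycle
blocks projects `D^even_{6j}` onto `classSumA (2j) · per_{2j}`, and `classSumA (2j) ≠ 0` because the
number of colourable (= all-cycles-even) permutations of `Fin (2j)` is odd. [folklore] -/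
theorem evenCycleDominance_proof : Theses.ImmanantSlice.EvenCycleDominance :=
  evenCycleDominance_of_classSumA fun j => by
    rw [mul_comm]
    exact classSumA_ne_zero (j + 1)

end Summit.ValiantsHypothesis.ValiantsHypothesis.Theorems.ImmanantSlice
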